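import Summits.CriticalPhenomena.PercolationContinuityZ3.Theorems.PercNearOneGluingNoHeavyLowerTailMonoRhoCexTools

/-!
# `NoHeavyLowerTail` (stmt-CriticalPhenomena-4575) — the FULL-MENU per-relay ratio step "MONO-ρ" with the sharp loss
# `|A|/(|A|−1)` is FALSE: a certified weighted counterexample on eight vertices (kernel no-go `not_monoRho_7_3`)

Prover `prim-lf-5` (lemma factory #5, blob-quotient / deletion induction on `|A|`), `--supports stmt-CriticalPhenomena-4575`.
No named facts, no definitions, no sorries; standard axioms (`decide +kernel`, no `native_decide`).

MONO-ρ (crux evidence LF5-CANDIDATES.md §A5; ttrl2 census request `lf5-mono-rho`, `run/shared/lean/ttrl/monorho/README.md`)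
was the one output of the blob-quotient technique that survived the convexity obstruction (LF5-INDUCTION-NOGO.md):
with `μ = prodBernoulli w`, relays `A` (`|A| = k`), observer `o ∉ A`, level `j`, `bad_j(B) = μ{1 ≤ |C(o) ∩ B| ≤ j}`,
`I_j(B; a) = μ{|C(a) ∩ B| ≤ j}` and `r(G) = bad_j(A) / max_{a ∈ A} I_j(A; a)`, it asserts that on every LADDER cell
`j + 3 ≤ k ≤ 2j + 1` some single-relay move `G'` — `DS(y)` (`y` leaves `A`), `W(y)` (the vertex `y` is deleted:
`w' e = 0` for `y ∈ e`), or `Q(x, y)` with `x ∈ A ∖ y` (`w' = w[s(x,y) ↦ 1]`, `y` leaves `A`) — satisfies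
`r(G') ≥ ((k−1)/k) · r(G)`.  Written without the quotient (`max` over `A` becomes `∃ a ∈ A`, `max` over `A ∖ y` becomes
`∀ a' ∈ A ∖ y`): `∃ y, G', ∃ a ∈ A, ∀ a' ∈ A ∖ y, (k−1) · bad_j(A) · I_j(G'; a') ≤ k · bad_j(G') · I_j(A; a)` — this is
the hypothesis below, VERBATIM the census statement at the cells the telescoping induction of `…MonoRhoReduction.lean`
visits.  The losses `k/(k−1)` would telescope to `2` and close the crux via `noHeavyLowerTail_of_fatMinorityLinear`.

THE CENSUS VERDICT (ttrl2, RESULT 05:30Z + addendum 05:40Z, ≈ 35 core-h: exhaustive (5,2)/(6,3), vertex-transitive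
ladder k ≤ 9, 1.5 M random Steiner supports, 12 000 block-move climbs): the sharp constant holds at every ladder cell
EXCEPT `(7, 3)`, where "three glued pairs + a singleton in a ring, observer weak on the singleton" gives
`Λ_r = r / max r' ` up to `1.2212 > 7/6` (odd `k`: pairs cannot tile `A`; demoting the singleton is the best move and loses
more than `1/7` of `r`).  `k(Λ_r − 1)` stays bounded (≤ 1.55) in everything run, and CIL itself (`r ≤ 1`) holds in every
instance, so the dichotomy stub `stub_monoRhoStepLadder` ("CIL witness OR lossy step") is NOT contradicted — only the
sharp-constant full-menu step is.  This file puts that closed door in the tree.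

WITNESS (`MonoRhoCex.wit73`, `n = 8`, observer `0`, `A = {1,…,7}`, `j = 3`): glued pairs `12, 34, 56` (weight `1`), pair
links `23, 45` (`4/5`), singleton `7` with links `67, 17` (`11/12`), observer edge `07` (`1/10`).  Exactly:
`bad_3(A) = 3/800`, `max_a I_3(A; a) = I_3(A; 3) = 1/25`, `r = 3/32`; over all `7 + 7 + 42` moves the best is `DS(7)`
with `r' = (11/3600)/(1/25) = 11/144`, so `Λ_r = 27/22 = 1.2273 > 7/6` (normalised `1.052`, `k(Λ_r − 1) = 1.59`);
for EVERY move `7 · bad_3(G') · (1/25) < 6 · (3/800) · max I_3(G'; ·)`, i.e. `r(G') < (6/7) · r(G)` (`facts_1 … facts_7`,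
kernel arithmetic over the pruned `2⁵`–`2⁶` configurations of each modified edge list; checker, move algebra
`wOfList_delV` / `update_wOfList_one` and evaluation lemmas in `…MonoRhoCexTools.lean`).  Reproduction (exact rational
brute force, also re-deriving the README witness `Λ_r = 912182793691211927061/778169564093736247741`):
`run/shared/lean/prim/prim-lf-5/code/mr73.py`.
-/

namespace Summit.CriticalPhenomena.PercolationContinuityZ3.Theorems

open MeasureTheory
open Literature.Probability.LatticeModels Literature.Probability.Percolation
open Summit.CriticalPhenomena.PercolationContinuityZ3.Theorems.AdditiveGluing.Negative.Cert

namespace MonoRhoCex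

/-! ### The 56 move facts (kernel reduction; `a'` = a lightness champion of the modified instance) -/

/-- Move facts for `y = 1` (DS, W, then Q(x,1) for the six `x`): `7 · bad' · (1/25) < 6 · (3/800) · I'(a')`, i.e.
`7 · bad_3(G') · max I_3(A; ·) < 6 · bad_3(A) · I_3(G'; a')`, at the champion `a'` of the reduced instance `G'`. [this file] -/
theorem facts_1 :
    7 * cntBad wit73 (A7.erase 1) * (1/25 : ℚ) < 6 * (3/800 : ℚ) * cntLight wit73 (A7.erase 1) 3 ∧
    7 * cntBad (delV 1 wit73) (A7.erase 1) * (1/25 : ℚ) < 6 * (3/800 : ℚ) * cntLight (delV 1 wit73) (A7.erase 1) 2 ∧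
    7 * cntBad (glueE 2 1 wit73) (A7.erase 1) * (1/25 : ℚ) < 6 * (3/800 : ℚ) * cntLight (glueE 2 1 wit73) (A7.erase 1) 3 ∧
    7 * cntBad (glueE 3 1 wit73) (A7.erase 1) * (1/25 : ℚ) < 6 * (3/800 : ℚ) * cntLight (glueE 3 1 wit73) (A7.erase 1) 5 ∧
    7 * cntBad (glueE 4 1 wit73) (A7.erase 1) * (1/25 : ℚ) < 6 * (3/800 : ℚ) * cntLight (glueE 4 1 wit73) (A7.erase 1) 5 ∧
    7 * cntBad (glueE 5 1 wit73) (A7.erase 1) * (1/25 : ℚ) < 6 * (3/800 : ℚ) * cntLight (glueE 5 1 wit73) (A7.erase 1) 3 ∧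
    7 * cntBad (glueE 6 1 wit73) (A7.erase 1) * (1/25 : ℚ) < 6 * (3/800 : ℚ) * cntLight (glueE 6 1 wit73) (A7.erase 1) 3 ∧
    7 * cntBad (glueE 7 1 wit73) (A7.erase 1) * (1/25 : ℚ) < 6 * (3/800 : ℚ) * cntLight (glueE 7 1 wit73) (A7.erase 1) 3 := by
  decide +kernel

/-- Move facts for `y = 2` (DS, W, then Q(x,2) for the six `x`): `7 · bad' · (1/25) < 6 · (3/800) · I'(a')`, i.e.
`7 · bad_3(G') · max I_3(A; ·) < 6 · bad_3(A) · I_3(G'; a')`, at the champion `a'` of the reduced instance `G'`. [this file] -/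
theorem facts_2 :
    7 * cntBad wit73 (A7.erase 2) * (1/25 : ℚ) < 6 * (3/800 : ℚ) * cntLight wit73 (A7.erase 2) 3 ∧
    7 * cntBad (delV 2 wit73) (A7.erase 2) * (1/25 : ℚ) < 6 * (3/800 : ℚ) * cntLight (delV 2 wit73) (A7.erase 2) 3 ∧
    7 * cntBad (glueE 1 2 wit73) (A7.erase 2) * (1/25 : ℚ) < 6 * (3/800 : ℚ) * cntLight (glueE 1 2 wit73) (A7.erase 2) 3 ∧
    7 * cntBad (glueE 3 2 wit73) (A7.erase 2) * (1/25 : ℚ) < 6 * (3/800 : ℚ) * cntLight (glueE 3 2 wit73) (A7.erase 2) 5 ∧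
    7 * cntBad (glueE 4 2 wit73) (A7.erase 2) * (1/25 : ℚ) < 6 * (3/800 : ℚ) * cntLight (glueE 4 2 wit73) (A7.erase 2) 5 ∧
    7 * cntBad (glueE 5 2 wit73) (A7.erase 2) * (1/25 : ℚ) < 6 * (3/800 : ℚ) * cntLight (glueE 5 2 wit73) (A7.erase 2) 3 ∧
    7 * cntBad (glueE 6 2 wit73) (A7.erase 2) * (1/25 : ℚ) < 6 * (3/800 : ℚ) * cntLight (glueE 6 2 wit73) (A7.erase 2) 3 ∧
    7 * cntBad (glueE 7 2 wit73) (A7.erase 2) * (1/25 : ℚ) < 6 * (3/800 : ℚ) * cntLight (glueE 7 2 wit73) (A7.erase 2) 3 := by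
  decide +kernel

/-- Move facts for `y = 3` (DS, W, then Q(x,3) for the six `x`): `7 · bad' · (1/25) < 6 · (3/800) · I'(a')`, i.e.
`7 · bad_3(G') · max I_3(A; ·) < 6 · bad_3(A) · I_3(G'; a')`, at the champion `a'` of the reduced instance `G'`. [this file] -/
theorem facts_3 :
    7 * cntBad wit73 (A7.erase 3) * (1/25 : ℚ) < 6 * (3/800 : ℚ) * cntLight wit73 (A7.erase 3) 4 ∧
    7 * cntBad (delV 3 wit73) (A7.erase 3) * (1/25 : ℚ) < 6 * (3/800 : ℚ) * cntLight (delV 3 wit73) (A7.erase 3) 4 ∧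
    7 * cntBad (glueE 1 3 wit73) (A7.erase 3) * (1/25 : ℚ) < 6 * (3/800 : ℚ) * cntLight (glueE 1 3 wit73) (A7.erase 3) 5 ∧
    7 * cntBad (glueE 2 3 wit73) (A7.erase 3) * (1/25 : ℚ) < 6 * (3/800 : ℚ) * cntLight (glueE 2 3 wit73) (A7.erase 3) 5 ∧
    7 * cntBad (glueE 4 3 wit73) (A7.erase 3) * (1/25 : ℚ) < 6 * (3/800 : ℚ) * cntLight (glueE 4 3 wit73) (A7.erase 3) 4 ∧
    7 * cntBad (glueE 5 3 wit73) (A7.erase 3) * (1/25 : ℚ) < 6 * (3/800 : ℚ) * cntLight (glueE 5 3 wit73) (A7.erase 3) 1 ∧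
    7 * cntBad (glueE 6 3 wit73) (A7.erase 3) * (1/25 : ℚ) < 6 * (3/800 : ℚ) * cntLight (glueE 6 3 wit73) (A7.erase 3) 1 ∧
    7 * cntBad (glueE 7 3 wit73) (A7.erase 3) * (1/25 : ℚ) < 6 * (3/800 : ℚ) * cntLight (glueE 7 3 wit73) (A7.erase 3) 1 := by
  decide +kernel

/-- Move facts for `y = 4` (DS, W, then Q(x,4) for the six `x`): `7 · bad' · (1/25) < 6 · (3/800) · I'(a')`, i.e.
`7 · bad_3(G') · max I_3(A; ·) < 6 · bad_3(A) · I_3(G'; a')`, at the champion `a'` of the reduced instance `G'`. [this file] -/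
theorem facts_4 :
    7 * cntBad wit73 (A7.erase 4) * (1/25 : ℚ) < 6 * (3/800 : ℚ) * cntLight wit73 (A7.erase 4) 3 ∧
    7 * cntBad (delV 4 wit73) (A7.erase 4) * (1/25 : ℚ) < 6 * (3/800 : ℚ) * cntLight (delV 4 wit73) (A7.erase 4) 3 ∧
    7 * cntBad (glueE 1 4 wit73) (A7.erase 4) * (1/25 : ℚ) < 6 * (3/800 : ℚ) * cntLight (glueE 1 4 wit73) (A7.erase 4) 5 ∧
    7 * cntBad (glueE 2 4 wit73) (A7.erase 4) * (1/25 : ℚ) < 6 * (3/800 : ℚ) * cntLight (glueE 2 4 wit73) (A7.erase 4) 5 ∧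
    7 * cntBad (glueE 3 4 wit73) (A7.erase 4) * (1/25 : ℚ) < 6 * (3/800 : ℚ) * cntLight (glueE 3 4 wit73) (A7.erase 4) 3 ∧
    7 * cntBad (glueE 5 4 wit73) (A7.erase 4) * (1/25 : ℚ) < 6 * (3/800 : ℚ) * cntLight (glueE 5 4 wit73) (A7.erase 4) 1 ∧
    7 * cntBad (glueE 6 4 wit73) (A7.erase 4) * (1/25 : ℚ) < 6 * (3/800 : ℚ) * cntLight (glueE 6 4 wit73) (A7.erase 4) 1 ∧
    7 * cntBad (glueE 7 4 wit73) (A7.erase 4) * (1/25 : ℚ) < 6 * (3/800 : ℚ) * cntLight (glueE 7 4 wit73) (A7.erase 4) 1 := by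
  decide +kernel

/-- Move facts for `y = 5` (DS, W, then Q(x,5) for the six `x`): `7 · bad' · (1/25) < 6 · (3/800) · I'(a')`, i.e.
`7 · bad_3(G') · max I_3(A; ·) < 6 · bad_3(A) · I_3(G'; a')`, at the champion `a'` of the reduced instance `G'`. [this file] -/
theorem facts_5 :
    7 * cntBad wit73 (A7.erase 5) * (1/25 : ℚ) < 6 * (3/800 : ℚ) * cntLight wit73 (A7.erase 5) 3 ∧
    7 * cntBad (delV 5 wit73) (A7.erase 5) * (1/25 : ℚ) < 6 * (3/800 : ℚ) * cntLight (delV 5 wit73) (A7.erase 5) 3 ∧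
    7 * cntBad (glueE 1 5 wit73) (A7.erase 5) * (1/25 : ℚ) < 6 * (3/800 : ℚ) * cntLight (glueE 1 5 wit73) (A7.erase 5) 3 ∧
    7 * cntBad (glueE 2 5 wit73) (A7.erase 5) * (1/25 : ℚ) < 6 * (3/800 : ℚ) * cntLight (glueE 2 5 wit73) (A7.erase 5) 3 ∧
    7 * cntBad (glueE 3 5 wit73) (A7.erase 5) * (1/25 : ℚ) < 6 * (3/800 : ℚ) * cntLight (glueE 3 5 wit73) (A7.erase 5) 1 ∧
    7 * cntBad (glueE 4 5 wit73) (A7.erase 5) * (1/25 : ℚ) < 6 * (3/800 : ℚ) * cntLight (glueE 4 5 wit73) (A7.erase 5) 1 ∧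
    7 * cntBad (glueE 6 5 wit73) (A7.erase 5) * (1/25 : ℚ) < 6 * (3/800 : ℚ) * cntLight (glueE 6 5 wit73) (A7.erase 5) 3 ∧
    7 * cntBad (glueE 7 5 wit73) (A7.erase 5) * (1/25 : ℚ) < 6 * (3/800 : ℚ) * cntLight (glueE 7 5 wit73) (A7.erase 5) 3 := by
  decide +kernel

/-- Move facts for `y = 6` (DS, W, then Q(x,6) for the six `x`): `7 · bad' · (1/25) < 6 · (3/800) · I'(a')`, i.e.
`7 · bad_3(G') · max I_3(A; ·) < 6 · bad_3(A) · I_3(G'; a')`, at the champion `a'` of the reduced instance `G'`. [this file] -/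
theorem facts_6 :
    7 * cntBad wit73 (A7.erase 6) * (1/25 : ℚ) < 6 * (3/800 : ℚ) * cntLight wit73 (A7.erase 6) 3 ∧
    7 * cntBad (delV 6 wit73) (A7.erase 6) * (1/25 : ℚ) < 6 * (3/800 : ℚ) * cntLight (delV 6 wit73) (A7.erase 6) 5 ∧
    7 * cntBad (glueE 1 6 wit73) (A7.erase 6) * (1/25 : ℚ) < 6 * (3/800 : ℚ) * cntLight (glueE 1 6 wit73) (A7.erase 6) 3 ∧
    7 * cntBad (glueE 2 6 wit73) (A7.erase 6) * (1/25 : ℚ) < 6 * (3/800 : ℚ) * cntLight (glueE 2 6 wit73) (A7.erase 6) 3 ∧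
    7 * cntBad (glueE 3 6 wit73) (A7.erase 6) * (1/25 : ℚ) < 6 * (3/800 : ℚ) * cntLight (glueE 3 6 wit73) (A7.erase 6) 1 ∧
    7 * cntBad (glueE 4 6 wit73) (A7.erase 6) * (1/25 : ℚ) < 6 * (3/800 : ℚ) * cntLight (glueE 4 6 wit73) (A7.erase 6) 1 ∧
    7 * cntBad (glueE 5 6 wit73) (A7.erase 6) * (1/25 : ℚ) < 6 * (3/800 : ℚ) * cntLight (glueE 5 6 wit73) (A7.erase 6) 3 ∧
    7 * cntBad (glueE 7 6 wit73) (A7.erase 6) * (1/25 : ℚ) < 6 * (3/800 : ℚ) * cntLight (glueE 7 6 wit73) (A7.erase 6) 3 := by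
  decide +kernel

/-- Move facts for `y = 7` (DS, W, then Q(x,7) for the six `x`): `7 · bad' · (1/25) < 6 · (3/800) · I'(a')`, i.e.
`7 · bad_3(G') · max I_3(A; ·) < 6 · bad_3(A) · I_3(G'; a')`, at the champion `a'` of the reduced instance `G'`. [this file] -/
theorem facts_7 :
    7 * cntBad wit73 (A7.erase 7) * (1/25 : ℚ) < 6 * (3/800 : ℚ) * cntLight wit73 (A7.erase 7) 3 ∧
    7 * cntBad (delV 7 wit73) (A7.erase 7) * (1/25 : ℚ) < 6 * (3/800 : ℚ) * cntLight (delV 7 wit73) (A7.erase 7) 1 ∧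
    7 * cntBad (glueE 1 7 wit73) (A7.erase 7) * (1/25 : ℚ) < 6 * (3/800 : ℚ) * cntLight (glueE 1 7 wit73) (A7.erase 7) 3 ∧
    7 * cntBad (glueE 2 7 wit73) (A7.erase 7) * (1/25 : ℚ) < 6 * (3/800 : ℚ) * cntLight (glueE 2 7 wit73) (A7.erase 7) 3 ∧
    7 * cntBad (glueE 3 7 wit73) (A7.erase 7) * (1/25 : ℚ) < 6 * (3/800 : ℚ) * cntLight (glueE 3 7 wit73) (A7.erase 7) 1 ∧
    7 * cntBad (glueE 4 7 wit73) (A7.erase 7) * (1/25 : ℚ) < 6 * (3/800 : ℚ) * cntLight (glueE 4 7 wit73) (A7.erase 7) 1 ∧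
    7 * cntBad (glueE 5 7 wit73) (A7.erase 7) * (1/25 : ℚ) < 6 * (3/800 : ℚ) * cntLight (glueE 5 7 wit73) (A7.erase 7) 3 ∧
    7 * cntBad (glueE 6 7 wit73) (A7.erase 7) * (1/25 : ℚ) < 6 * (3/800 : ℚ) * cntLight (glueE 6 7 wit73) (A7.erase 7) 3 := by
  decide +kernel


/-! ### From one move fact to the failure of the step for that move -/

open scoped Classical in
/-- **One move.**  If the modified weighted edge list `l'` (relay set `B = A ∖ y`) satisfies the kernel fact
`7 · bad_3(l'; B) · (1/25) < 6 · (3/800) · I_3(l'; B; a')` for some `a' ∈ B`, then the MONO-ρ inequality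
`(|A| − 1) · bad_3(A) · I_3(l'; B; a'') ≤ |A| · bad_3(l'; B) · I_3(A; a)` cannot hold for all `a'' ∈ B`, whatever the
reference relay `a ∈ A` (`I_3(A; a) ≤ 1/25 = max`, `champion`; `bad_3(A) = 3/800`, `wit73_bad`). [this file] -/
theorem move_absurd {l' : List (Fin 8 × Fin 8 × ℚ)} (hnd' : (wPairs l').Nodup)
    (hq' : ∀ e ∈ l', 0 ≤ e.2.2 ∧ e.2.2 ≤ 1) {B : Finset (Fin 8)} {a a' : Fin 8} (ha : a ∈ A7) (ha' : a' ∈ B)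
    (hfact : 7 * cntBad l' B * (1/25 : ℚ) < 6 * (3/800 : ℚ) * cntLight l' B a')
    (hall : ∀ a'' ∈ B,
      ((A7.card : ℝ) - 1) *
          (prodBernoulli (wOfList wit73)).real {ω : BondConfig (Fin 8) |
              1 ≤ (A7.filter fun x => ω ∈ openConn (0 : Fin 8) x).card ∧
                (A7.filter fun x => ω ∈ openConn (0 : Fin 8) x).card ≤ 3} *
        (prodBernoulli (wOfList l')).real {ω : BondConfig (Fin 8) |
            (B.filter fun x => ω ∈ openConn a'' x).card ≤ 3} ≤
      (A7.card : ℝ) *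
          (prodBernoulli (wOfList l')).real {ω : BondConfig (Fin 8) |
              1 ≤ (B.filter fun x => ω ∈ openConn (0 : Fin 8) x).card ∧
                (B.filter fun x => ω ∈ openConn (0 : Fin 8) x).card ≤ 3} *
        (prodBernoulli (wOfList wit73)).real {ω : BondConfig (Fin 8) |
            (A7.filter fun x => ω ∈ openConn a x).card ≤ 3}) : False := by
  have h := hall a' ha'
  rw [real_bad wit73_nodup wit73_weights, real_light hnd' hq', real_bad hnd' hq',
    real_light wit73_nodup wit73_weights, wit73_bad, A7_card] at h
  have hI : (cntLight wit73 A7 a : ℝ) ≤ ((1/25 : ℚ) : ℝ) := by exact_mod_cast champion a ha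
  have hb : (0 : ℝ) ≤ (cntBad l' B : ℝ) := cntBad_nonneg hnd' hq' B
  have hf : (7 : ℝ) * (cntBad l' B : ℝ) * ((1/25 : ℚ) : ℝ) < 6 * ((3/800 : ℚ) : ℝ) * (cntLight l' B a' : ℝ) := by
    exact_mod_cast hfact
  have hm : (7 : ℝ) * (cntBad l' B : ℝ) * (cntLight wit73 A7 a : ℝ) ≤ 7 * (cntBad l' B : ℝ) * ((1/25 : ℚ) : ℝ) :=
    mul_le_mul_of_nonneg_left hI (by positivity)
  push_cast at h hf hm
  linarith

end MonoRhoCex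

open MonoRhoCex
open scoped Classical

/-- **MONO-ρ with the sharp loss `|A|/(|A|−1)` is FALSE on the ladder (kernel no-go, cell `(|A|, j) = (7, 3)`).**
The refuted statement, verbatim the censused one (`run/shared/lean/ttrl/monorho/README.md`; crux evidence
LF5-CANDIDATES.md §A5): for all `j, n, w, A, o` with `o ∉ A` and `j + 3 ≤ |A| ≤ 2j + 1` there are a relay `y ∈ A`, a
single-relay move `w' ∈ {w (DS: y merely leaves A), w with the vertex y deleted (W), w[s(x,y) ↦ 1] for some x ∈ A ∖ y (Q)}`
and a reference relay `a ∈ A` such that for every `a' ∈ A ∖ y`: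
`(|A| − 1) · bad_j(w; A) · I_j(w'; A ∖ y; a') ≤ |A| · bad_j(w'; A ∖ y) · I_j(w; A; a)` — i.e.
`max_{moves} r(G') ≥ ((|A|−1)/|A|) · r(G)` for `r = bad / max I`.  At the eight-vertex witness `MonoRhoCex.wit73` (three
glued relay pairs and a singleton relay in a ring, observer attached with weight `1/10` to the singleton), `j = 3`,
`A = {1,…,7}`: `r(G) = 3/32` and every one of the 56 moves has `r(G') < (6/7) · r(G)` (best: `DS(7)`, `r' = 11/144`,
loss factor `27/22 > 7/6`).  The dichotomy stub `stub_monoRhoStepLadder` is unaffected (a CIL witness exists here: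
`r ≤ 1`). [this file; census run/shared/lean/ttrl/monorho/README.md RESULT 05:30Z] -/
theorem not_monoRho_7_3 :
    ¬ (∀ (j n : ℕ) (w : Sym2 (Fin n) → unitInterval) (A : Finset (Fin n)) (o : Fin n),
        o ∉ A → j + 3 ≤ A.card → A.card ≤ 2 * j + 1 →
        ∃ y ∈ A, ∃ w' : Sym2 (Fin n) → unitInterval,
          (w' = w ∨ w' = (fun e => if y ∈ e then 0 else w e) ∨ ∃ x ∈ A.erase y, w' = Function.update w s(x, y) 1) ∧
          ∃ a ∈ A, ∀ a' ∈ A.erase y,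
            ((A.card : ℝ) - 1) *
                (prodBernoulli w).real {ω : BondConfig (Fin n) |
                    1 ≤ (A.filter fun x => ω ∈ openConn o x).card ∧ (A.filter fun x => ω ∈ openConn o x).card ≤ j} *
              (prodBernoulli w').real {ω : BondConfig (Fin n) |
                  ((A.erase y).filter fun x => ω ∈ openConn a' x).card ≤ j} ≤
            (A.card : ℝ) *
                (prodBernoulli w').real {ω : BondConfig (Fin n) |
                    1 ≤ ((A.erase y).filter fun x => ω ∈ openConn o x).card ∧
                      ((A.erase y).filter fun x => ω ∈ openConn o x).card ≤ j} *
              (prodBernoulli w).real {ω : BondConfig (Fin n) | (A.filter fun x => ω ∈ openConn a x).card ≤ j}) := by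
  intro h
  obtain ⟨y, hy, w', hw', a, ha, hall⟩ := h 3 8 (wOfList wit73) A7 0 (by decide) (by decide) (by decide)
  have keyA : ∀ z : Fin 8, z ∈ A7 → z = 1 ∨ z = 2 ∨ z = 3 ∨ z = 4 ∨ z = 5 ∨ z = 6 ∨ z = 7 := by decide
  rcases keyA y hy with rfl | rfl | rfl | rfl | rfl | rfl | rfl
  · -- y = 1: DS(1), W(1), Q(x,1)
    rcases hw' with rfl | rfl | ⟨x, hx, rfl⟩
    · exact move_absurd wit73_nodup wit73_weights ha (by decide) facts_1.1 hall
    · rw [wOfList_delV] at hall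
      exact move_absurd (by rw [wPairs_delV]; exact wit73_nodup) (delV_weights _ _ wit73_weights) ha (by decide)
        facts_1.2.1 hall
    · have key : ∀ z : Fin 8, z ∈ A7.erase 1 → z = 2 ∨ z = 3 ∨ z = 4 ∨ z = 5 ∨ z = 6 ∨ z = 7 := by decide
      rw [update_wOfList_one] at hall
      rcases key x hx with rfl | rfl | rfl | rfl | rfl | rfl
      · exact move_absurd (glueE_nodup _ _ _ wit73_nodup) (glueE_weights _ _ _ wit73_weights) ha (by decide)
          facts_1.2.2.1 hall
      · exact move_absurd (glueE_nodup _ _ _ wit73_nodup) (glueE_weights _ _ _ wit73_weights) ha (by decide)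
          facts_1.2.2.2.1 hall
      · exact move_absurd (glueE_nodup _ _ _ wit73_nodup) (glueE_weights _ _ _ wit73_weights) ha (by decide)
          facts_1.2.2.2.2.1 hall
      · exact move_absurd (glueE_nodup _ _ _ wit73_nodup) (glueE_weights _ _ _ wit73_weights) ha (by decide)
          facts_1.2.2.2.2.2.1 hall
      · exact move_absurd (glueE_nodup _ _ _ wit73_nodup) (glueE_weights _ _ _ wit73_weights) ha (by decide)
          facts_1.2.2.2.2.2.2.1 hall
      · exact move_absurd (glueE_nodup _ _ _ wit73_nodup) (glueE_weights _ _ _ wit73_weights) ha (by decide)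
          facts_1.2.2.2.2.2.2.2 hall
  · -- y = 2: DS(2), W(2), Q(x,2)
    rcases hw' with rfl | rfl | ⟨x, hx, rfl⟩
    · exact move_absurd wit73_nodup wit73_weights ha (by decide) facts_2.1 hall
    · rw [wOfList_delV] at hall
      exact move_absurd (by rw [wPairs_delV]; exact wit73_nodup) (delV_weights _ _ wit73_weights) ha (by decide)
        facts_2.2.1 hall
    · have key : ∀ z : Fin 8, z ∈ A7.erase 2 → z = 1 ∨ z = 3 ∨ z = 4 ∨ z = 5 ∨ z = 6 ∨ z = 7 := by decide
      rw [update_wOfList_one] at hall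
      rcases key x hx with rfl | rfl | rfl | rfl | rfl | rfl
      · exact move_absurd (glueE_nodup _ _ _ wit73_nodup) (glueE_weights _ _ _ wit73_weights) ha (by decide)
          facts_2.2.2.1 hall
      · exact move_absurd (glueE_nodup _ _ _ wit73_nodup) (glueE_weights _ _ _ wit73_weights) ha (by decide)
          facts_2.2.2.2.1 hall
      · exact move_absurd (glueE_nodup _ _ _ wit73_nodup) (glueE_weights _ _ _ wit73_weights) ha (by decide)
          facts_2.2.2.2.2.1 hall
      · exact move_absurd (glueE_nodup _ _ _ wit73_nodup) (glueE_weights _ _ _ wit73_weights) ha (by decide)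
          facts_2.2.2.2.2.2.1 hall
      · exact move_absurd (glueE_nodup _ _ _ wit73_nodup) (glueE_weights _ _ _ wit73_weights) ha (by decide)
          facts_2.2.2.2.2.2.2.1 hall
      · exact move_absurd (glueE_nodup _ _ _ wit73_nodup) (glueE_weights _ _ _ wit73_weights) ha (by decide)
          facts_2.2.2.2.2.2.2.2 hall
  · -- y = 3: DS(3), W(3), Q(x,3)
    rcases hw' with rfl | rfl | ⟨x, hx, rfl⟩
    · exact move_absurd wit73_nodup wit73_weights ha (by decide) facts_3.1 hall
    · rw [wOfList_delV] at hall
      exact move_absurd (by rw [wPairs_delV]; exact wit73_nodup) (delV_weights _ _ wit73_weights) ha (by decide)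
        facts_3.2.1 hall
    · have key : ∀ z : Fin 8, z ∈ A7.erase 3 → z = 1 ∨ z = 2 ∨ z = 4 ∨ z = 5 ∨ z = 6 ∨ z = 7 := by decide
      rw [update_wOfList_one] at hall
      rcases key x hx with rfl | rfl | rfl | rfl | rfl | rfl
      · exact move_absurd (glueE_nodup _ _ _ wit73_nodup) (glueE_weights _ _ _ wit73_weights) ha (by decide)
          facts_3.2.2.1 hall
      · exact move_absurd (glueE_nodup _ _ _ wit73_nodup) (glueE_weights _ _ _ wit73_weights) ha (by decide)
          facts_3.2.2.2.1 hall
      · exact move_absurd (glueE_nodup _ _ _ wit73_nodup) (glueE_weights _ _ _ wit73_weights) ha (by decide)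
          facts_3.2.2.2.2.1 hall
      · exact move_absurd (glueE_nodup _ _ _ wit73_nodup) (glueE_weights _ _ _ wit73_weights) ha (by decide)
          facts_3.2.2.2.2.2.1 hall
      · exact move_absurd (glueE_nodup _ _ _ wit73_nodup) (glueE_weights _ _ _ wit73_weights) ha (by decide)
          facts_3.2.2.2.2.2.2.1 hall
      · exact move_absurd (glueE_nodup _ _ _ wit73_nodup) (glueE_weights _ _ _ wit73_weights) ha (by decide)
          facts_3.2.2.2.2.2.2.2 hall
  · -- y = 4: DS(4), W(4), Q(x,4)
    rcases hw' with rfl | rfl | ⟨x, hx, rfl⟩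
    · exact move_absurd wit73_nodup wit73_weights ha (by decide) facts_4.1 hall
    · rw [wOfList_delV] at hall
      exact move_absurd (by rw [wPairs_delV]; exact wit73_nodup) (delV_weights _ _ wit73_weights) ha (by decide)
        facts_4.2.1 hall
    · have key : ∀ z : Fin 8, z ∈ A7.erase 4 → z = 1 ∨ z = 2 ∨ z = 3 ∨ z = 5 ∨ z = 6 ∨ z = 7 := by decide
      rw [update_wOfList_one] at hall
      rcases key x hx with rfl | rfl | rfl | rfl | rfl | rfl
      · exact move_absurd (glueE_nodup _ _ _ wit73_nodup) (glueE_weights _ _ _ wit73_weights) ha (by decide)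
          facts_4.2.2.1 hall
      · exact move_absurd (glueE_nodup _ _ _ wit73_nodup) (glueE_weights _ _ _ wit73_weights) ha (by decide)
          facts_4.2.2.2.1 hall
      · exact move_absurd (glueE_nodup _ _ _ wit73_nodup) (glueE_weights _ _ _ wit73_weights) ha (by decide)
          facts_4.2.2.2.2.1 hall
      · exact move_absurd (glueE_nodup _ _ _ wit73_nodup) (glueE_weights _ _ _ wit73_weights) ha (by decide)
          facts_4.2.2.2.2.2.1 hall
      · exact move_absurd (glueE_nodup _ _ _ wit73_nodup) (glueE_weights _ _ _ wit73_weights) ha (by decide)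
          facts_4.2.2.2.2.2.2.1 hall
      · exact move_absurd (glueE_nodup _ _ _ wit73_nodup) (glueE_weights _ _ _ wit73_weights) ha (by decide)
          facts_4.2.2.2.2.2.2.2 hall
  · -- y = 5: DS(5), W(5), Q(x,5)
    rcases hw' with rfl | rfl | ⟨x, hx, rfl⟩
    · exact move_absurd wit73_nodup wit73_weights ha (by decide) facts_5.1 hall
    · rw [wOfList_delV] at hall
      exact move_absurd (by rw [wPairs_delV]; exact wit73_nodup) (delV_weights _ _ wit73_weights) ha (by decide)
        facts_5.2.1 hall
    · have key : ∀ z : Fin 8, z ∈ A7.erase 5 → z = 1 ∨ z = 2 ∨ z = 3 ∨ z = 4 ∨ z = 6 ∨ z = 7 := by decide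
      rw [update_wOfList_one] at hall
      rcases key x hx with rfl | rfl | rfl | rfl | rfl | rfl
      · exact move_absurd (glueE_nodup _ _ _ wit73_nodup) (glueE_weights _ _ _ wit73_weights) ha (by decide)
          facts_5.2.2.1 hall
      · exact move_absurd (glueE_nodup _ _ _ wit73_nodup) (glueE_weights _ _ _ wit73_weights) ha (by decide)
          facts_5.2.2.2.1 hall
      · exact move_absurd (glueE_nodup _ _ _ wit73_nodup) (glueE_weights _ _ _ wit73_weights) ha (by decide)
          facts_5.2.2.2.2.1 hall
      · exact move_absurd (glueE_nodup _ _ _ wit73_nodup) (glueE_weights _ _ _ wit73_weights) ha (by decide)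
          facts_5.2.2.2.2.2.1 hall
      · exact move_absurd (glueE_nodup _ _ _ wit73_nodup) (glueE_weights _ _ _ wit73_weights) ha (by decide)
          facts_5.2.2.2.2.2.2.1 hall
      · exact move_absurd (glueE_nodup _ _ _ wit73_nodup) (glueE_weights _ _ _ wit73_weights) ha (by decide)
          facts_5.2.2.2.2.2.2.2 hall
  · -- y = 6: DS(6), W(6), Q(x,6)
    rcases hw' with rfl | rfl | ⟨x, hx, rfl⟩
    · exact move_absurd wit73_nodup wit73_weights ha (by decide) facts_6.1 hall
    · rw [wOfList_delV] at hall
      exact move_absurd (by rw [wPairs_delV]; exact wit73_nodup) (delV_weights _ _ wit73_weights) ha (by decide)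
        facts_6.2.1 hall
    · have key : ∀ z : Fin 8, z ∈ A7.erase 6 → z = 1 ∨ z = 2 ∨ z = 3 ∨ z = 4 ∨ z = 5 ∨ z = 7 := by decide
      rw [update_wOfList_one] at hall
      rcases key x hx with rfl | rfl | rfl | rfl | rfl | rfl
      · exact move_absurd (glueE_nodup _ _ _ wit73_nodup) (glueE_weights _ _ _ wit73_weights) ha (by decide)
          facts_6.2.2.1 hall
      · exact move_absurd (glueE_nodup _ _ _ wit73_nodup) (glueE_weights _ _ _ wit73_weights) ha (by decide)
          facts_6.2.2.2.1 hall
      · exact move_absurd (glueE_nodup _ _ _ wit73_nodup) (glueE_weights _ _ _ wit73_weights) ha (by decide)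
          facts_6.2.2.2.2.1 hall
      · exact move_absurd (glueE_nodup _ _ _ wit73_nodup) (glueE_weights _ _ _ wit73_weights) ha (by decide)
          facts_6.2.2.2.2.2.1 hall
      · exact move_absurd (glueE_nodup _ _ _ wit73_nodup) (glueE_weights _ _ _ wit73_weights) ha (by decide)
          facts_6.2.2.2.2.2.2.1 hall
      · exact move_absurd (glueE_nodup _ _ _ wit73_nodup) (glueE_weights _ _ _ wit73_weights) ha (by decide)
          facts_6.2.2.2.2.2.2.2 hall
  · -- y = 7: DS(7), W(7), Q(x,7)
    rcases hw' with rfl | rfl | ⟨x, hx, rfl⟩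
    · exact move_absurd wit73_nodup wit73_weights ha (by decide) facts_7.1 hall
    · rw [wOfList_delV] at hall
      exact move_absurd (by rw [wPairs_delV]; exact wit73_nodup) (delV_weights _ _ wit73_weights) ha (by decide)
        facts_7.2.1 hall
    · have key : ∀ z : Fin 8, z ∈ A7.erase 7 → z = 1 ∨ z = 2 ∨ z = 3 ∨ z = 4 ∨ z = 5 ∨ z = 6 := by decide
      rw [update_wOfList_one] at hall
      rcases key x hx with rfl | rfl | rfl | rfl | rfl | rfl
      · exact move_absurd (glueE_nodup _ _ _ wit73_nodup) (glueE_weights _ _ _ wit73_weights) ha (by decide)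
          facts_7.2.2.1 hall
      · exact move_absurd (glueE_nodup _ _ _ wit73_nodup) (glueE_weights _ _ _ wit73_weights) ha (by decide)
          facts_7.2.2.2.1 hall
      · exact move_absurd (glueE_nodup _ _ _ wit73_nodup) (glueE_weights _ _ _ wit73_weights) ha (by decide)
          facts_7.2.2.2.2.1 hall
      · exact move_absurd (glueE_nodup _ _ _ wit73_nodup) (glueE_weights _ _ _ wit73_weights) ha (by decide)
          facts_7.2.2.2.2.2.1 hall
      · exact move_absurd (glueE_nodup _ _ _ wit73_nodup) (glueE_weights _ _ _ wit73_weights) ha (by decide)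
          facts_7.2.2.2.2.2.2.1 hall
      · exact move_absurd (glueE_nodup _ _ _ wit73_nodup) (glueE_weights _ _ _ wit73_weights) ha (by decide)
          facts_7.2.2.2.2.2.2.2 hall

end Summit.CriticalPhenomena.PercolationContinuityZ3.Theorems
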